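import Summits.CriticalPhenomena.CardyFormulaZ2.Theorems.CardyBoundaryCoulombGasHalfPlaneMarkDensityLawEquicontinuity
import Summits.CriticalPhenomena.CardyFormulaZ2.Theorems.CardyBoundaryCoulombGasHalfPlaneMarkDensityLawEquivalence

/-!
# Line `Sketch`, open stub C⁺ — a priori structure of the collinear half-plane crossing function, III:
# joint subsequential limits exist; their a priori properties (crux stmt-CriticalPhenomena-5661, lead c2-0)

`P_n(a,b,c,y) := P_{1/2}[[⌊an⌋,⌊bn⌋]×{0} ↔ [⌊cn⌋,⌊yn⌋]×{0} in ℤ×ℕ]`, chamber `a < b < c < y`.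

* §5 PRECOMPACTNESS (`exists_jointSubseqLimit`): every subsequence `φ` has a further subsequence
  `φ ∘ ψ` along which `P_n` converges at EVERY point of the chamber SIMULTANEOUSLY to some function
  `G` (diagonal extraction over rational marks in the compact metrisable cube `[0,1]^{ℚ⁴}`, then
  extension to real marks by the `δ`-move equicontinuity `eventually_move_le` and a Cauchy argument).
* §6 Every such joint subsequential limit `G` takes values in `[0,1]`, is monotone in each mark,
  continuous on the chamber (`continuousOn_of_jointLimit`), translation invariant
  (`translate_of_jointLimit`), and vanishes at `η = 0` from either side (`jointLimit_le_small_source`,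
  `jointLimit_le_small_target`, with universal constants: `exists_jointLimit_source_decay`,
  `exists_jointLimit_target_decay`).
* §7 (identification `⟺` C⁺ `⟺` crux) is in the companion file `…Identification`.
-/

noncomputable section

namespace Summit.CriticalPhenomena.CardyFormulaZ2.Cruxes.HalfPlaneMarkDensityLaw.SketchLine

open Literature.Probability.Percolation Literature.Probability.LatticeModels
open MeasureTheory Filter Set
open scoped Topology
open Summit.CriticalPhenomena.CardyFormulaZ2.Theses.CardyBoundaryCoulombGas (HalfPlaneMarkDensityLaw)
open Summit.CriticalPhenomena.CardyFormulaZ2.Theorems.HalfPlaneMarkDensityLaw.Negative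

namespace Subseq

/-! ## §5 Precompactness: joint subsequential limits exist -/

/-- **Diagonal extraction over rational marks.** Along a subsequence of any `φ`, `P_{φ n}` converges at
every rational quadruple of marks (sequential compactness of the compact metrisable cube
`[0,1]^{ℚ⁴}`). [folklore] -/
theorem exists_subseq_tendsto_rat (φ : ℕ → ℕ) :
    ∃ ψ : ℕ → ℕ, StrictMono ψ ∧ ∀ q : ℚ × ℚ × ℚ × ℚ, ∃ L : ℝ,
      Tendsto (fun n ↦ μ.real (openCrossing halfPlane (arcA q.1 q.2.1 (φ (ψ n)))
        (rowIcc ⌊(q.2.2.1 : ℝ) * (φ (ψ n) : ℕ)⌋ ⌊(q.2.2.2 : ℝ) * (φ (ψ n) : ℕ)⌋))) atTop (𝓝 L) := by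
  set x : ℕ → (ℚ × ℚ × ℚ × ℚ → ℝ) := fun n q ↦ μ.real (openCrossing halfPlane
    (arcA q.1 q.2.1 (φ n)) (rowIcc ⌊(q.2.2.1 : ℝ) * (φ n : ℕ)⌋ ⌊(q.2.2.2 : ℝ) * (φ n : ℕ)⌋)) with hx
  have hK : IsCompact (Set.pi univ fun _ : ℚ × ℚ × ℚ × ℚ ↦ Icc (0 : ℝ) 1) :=
    isCompact_univ_pi fun _ ↦ isCompact_Icc
  have hxK : ∀ n, x n ∈ Set.pi univ fun _ : ℚ × ℚ × ℚ × ℚ ↦ Icc (0 : ℝ) 1 :=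
    fun n q _ ↦ ⟨measureReal_nonneg, measureReal_le_one⟩
  obtain ⟨g, -, ψ, hψ, hlim⟩ := hK.tendsto_subseq hxK
  refine ⟨ψ, hψ, fun q ↦ ⟨g q, ?_⟩⟩
  have := tendsto_pi_nhds.1 hlim q
  simpa [hx] using this

/-- A small parameter below a threshold making the move error `4C(Kδ)^α` smaller than `ε`. [folklore] -/
theorem exists_small {C α : ℝ} (hα : 0 < α) (K : ℝ) {ε δ₀ : ℝ} (hε : 0 < ε) (hδ₀ : 0 < δ₀) :
    ∃ δ : ℝ, 0 < δ ∧ δ < δ₀ ∧ 4 * (C * (K * δ) ^ α) < ε := by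
  have hc : ContinuousAt (fun u : ℝ ↦ 4 * (C * (K * u) ^ α)) 0 := by
    refine ContinuousAt.mul continuousAt_const (ContinuousAt.mul continuousAt_const ?_)
    exact (Real.continuousAt_rpow_const _ α (Or.inr hα.le)).comp (by fun_prop)
  have h0 : 4 * (C * (K * (0 : ℝ)) ^ α) = 0 := by
    simp [Real.zero_rpow hα.ne']
  have h1 : Tendsto (fun k : ℕ ↦ 4 * (C * (K * ((1 : ℝ) / ((k : ℝ) + 1))) ^ α)) atTop (𝓝 0) := by
    have := hc.tendsto.comp (tendsto_one_div_add_atTop_nhds_zero_nat (𝕜 := ℝ))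
    rw [h0] at this
    exact this
  have e1 : ∀ᶠ k : ℕ in atTop, 4 * (C * (K * ((1 : ℝ) / ((k : ℝ) + 1))) ^ α) < ε :=
    h1 (Iio_mem_nhds hε)
  have e2 : ∀ᶠ k : ℕ in atTop, (1 : ℝ) / ((k : ℝ) + 1) < δ₀ :=
    (tendsto_one_div_add_atTop_nhds_zero_nat (𝕜 := ℝ)) (Iio_mem_nhds hδ₀)
  obtain ⟨k, hk1, hk2⟩ := (e1.and e2).exists
  exact ⟨1 / ((k : ℝ) + 1), by positivity, hk2, hk1⟩

/-- **Extension to real marks.** If `P_{θ n}` converges at every rational quadruple along a strictly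
increasing `θ`, it converges at every real point of the chamber (sandwich between the rational
corners `q⁻ ≼ z ≼ q⁺`, whose values differ by `≤ 4C(8δ/gap)^α` eventually, and completeness of `ℝ`).
[folklore] -/
theorem tendsto_real_of_tendsto_rat {θ : ℕ → ℕ} (hθ : StrictMono θ)
    (hrat : ∀ q : ℚ × ℚ × ℚ × ℚ, ∃ L : ℝ,
      Tendsto (fun n ↦ μ.real (openCrossing halfPlane (arcA q.1 q.2.1 (θ n))
        (rowIcc ⌊(q.2.2.1 : ℝ) * (θ n : ℕ)⌋ ⌊(q.2.2.2 : ℝ) * (θ n : ℕ)⌋))) atTop (𝓝 L))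
    {a b c y : ℝ} (hab : a < b) (hbc : b < c) (hcy : c < y) :
    ∃ L : ℝ, Tendsto (fun n ↦ μ.real (openCrossing halfPlane (arcA a b (θ n))
      (rowIcc ⌊c * (θ n : ℕ)⌋ ⌊y * (θ n : ℕ)⌋))) atTop (𝓝 L) := by
  obtain ⟨C, α, hC0, hα, hesc⟩ := exists_real_boxToFar_le_rpow_of_le_half
  set u : ℕ → ℝ := fun n ↦ μ.real (openCrossing halfPlane (arcA a b (θ n))
    (rowIcc ⌊c * (θ n : ℕ)⌋ ⌊y * (θ n : ℕ)⌋)) with hu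
  suffices hcs : CauchySeq u from cauchySeq_tendsto_of_complete hcs
  rw [Metric.cauchySeq_iff]
  intro ε hε
  -- a small δ
  have hg : 0 < c - b := by linarith
  obtain ⟨δ, hδ, hδ₀, herr⟩ := exists_small (C := C) hα (32 / (c - b)) (ε := ε / 4)
    (δ₀ := min (min ((b - a) / 2) ((y - c) / 2)) ((c - b) / 22)) (by positivity)
    (lt_min (lt_min (by linarith) (by linarith)) (by linarith))
  have hδ1 : δ < (b - a) / 2 := lt_of_lt_of_le hδ₀ ((min_le_left _ _).trans (min_le_left _ _))
  have hδ2 : δ < (y - c) / 2 := lt_of_lt_of_le hδ₀ ((min_le_left _ _).trans (min_le_right _ _))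
  have hδ3 : δ < (c - b) / 22 := lt_of_lt_of_le hδ₀ (min_le_right _ _)
  -- rational corners
  obtain ⟨ap, ha1, ha2⟩ := exists_rat_btwn (show a - δ < a by linarith)
  obtain ⟨bp, hb1, hb2⟩ := exists_rat_btwn (show b < b + δ by linarith)
  obtain ⟨cp, hc1, hc2⟩ := exists_rat_btwn (show c - δ < c by linarith)
  obtain ⟨yp, hy1, hy2⟩ := exists_rat_btwn (show y < y + δ by linarith)
  obtain ⟨am, ha3, ha4⟩ := exists_rat_btwn (show a < a + δ by linarith)
  obtain ⟨bm, hb3, hb4⟩ := exists_rat_btwn (show b - δ < b by linarith)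
  obtain ⟨cm, hc3, hc4⟩ := exists_rat_btwn (show c < c + δ by linarith)
  obtain ⟨ym, hy3, hy4⟩ := exists_rat_btwn (show y - δ < y by linarith)
  -- the move bound from the lower corner to the upper corner, along θ
  have hmove := hθ.tendsto_atTop.eventually (eventually_move_le hC0.le hα hesc
    (a := (am : ℝ)) (a' := (ap : ℝ)) (b := (bm : ℝ)) (b' := (bp : ℝ)) (c := (cm : ℝ)) (c' := (cp : ℝ))
    (y := (ym : ℝ)) (y' := (yp : ℝ)) (δ := 2 * δ) (by linarith) (by linarith) (by linarith)
    (by linarith) (by linarith) (by linarith) (by linarith) (by linarith) (by linarith) (by linarith)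
    (by linarith) (by linarith))
  have herr' : 4 * (C * (8 * (2 * δ) / ((cp : ℝ) - bp)) ^ α) < ε / 4 := by
    refine lt_of_le_of_lt ?_ herr
    have hgap : (c - b) / 2 ≤ (cp : ℝ) - bp := by linarith
    have h1 : 8 * (2 * δ) / ((cp : ℝ) - bp) ≤ 32 / (c - b) * δ := by
      rw [div_le_iff₀ (by linarith), div_mul_eq_mul_div, div_mul_eq_mul_div, le_div_iff₀ hg]
      nlinarith
    have h2 : (8 * (2 * δ) / ((cp : ℝ) - bp)) ^ α ≤ (32 / (c - b) * δ) ^ α :=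
      Real.rpow_le_rpow (div_nonneg (by positivity) (by linarith)) h1 hα.le
    nlinarith [mul_le_mul_of_nonneg_left h2 hC0.le]
  -- convergence at the lower corner gives a Cauchy modulus
  obtain ⟨L, hL⟩ := hrat (am, bm, cm, ym)
  simp only at hL
  have hL' := (Metric.tendsto_atTop.1 hL) (ε / 8) (by positivity)
  obtain ⟨N₁, hN₁⟩ := hL'
  obtain ⟨N₂, hN₂⟩ := eventually_atTop.1 hmove
  refine ⟨max N₁ N₂, fun m hm n hn ↦ ?_⟩
  have hm1 : N₁ ≤ m := le_of_max_le_left hm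
  have hn1 : N₁ ≤ n := le_of_max_le_left hn
  have hm2 : N₂ ≤ m := le_of_max_le_right hm
  have hn2 : N₂ ≤ n := le_of_max_le_right hn
  -- sandwiches
  have lo_m := P_mono (a := (am : ℝ)) (a' := a) (b := (bm : ℝ)) (b' := b) (c := (cm : ℝ)) (c' := c)
    (y := (ym : ℝ)) (y' := y) (by linarith) (by linarith) (by linarith) (by linarith) (θ m)
  have hi_m := P_mono (a := a) (a' := (ap : ℝ)) (b := b) (b' := (bp : ℝ)) (c := c) (c' := (cp : ℝ))
    (y := y) (y' := (yp : ℝ)) (by linarith) (by linarith) (by linarith) (by linarith) (θ m)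
  have lo_n := P_mono (a := (am : ℝ)) (a' := a) (b := (bm : ℝ)) (b' := b) (c := (cm : ℝ)) (c' := c)
    (y := (ym : ℝ)) (y' := y) (by linarith) (by linarith) (by linarith) (by linarith) (θ n)
  have hi_n := P_mono (a := a) (a' := (ap : ℝ)) (b := b) (b' := (bp : ℝ)) (c := c) (c' := (cp : ℝ))
    (y := y) (y' := (yp : ℝ)) (by linarith) (by linarith) (by linarith) (by linarith) (θ n)
  have mv_m := hN₂ m hm2
  have mv_n := hN₂ n hn2
  have cau_m := hN₁ m hm1
  have cau_n := hN₁ n hn1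
  rw [Real.dist_eq, abs_lt] at cau_m cau_n ⊢
  simp only [hu]
  constructor <;> linarith [cau_m.1, cau_m.2, cau_n.1, cau_n.2]

/-- **Precompactness of the collinear half-plane crossing function.** Every subsequence `φ` has a
further subsequence `φ ∘ ψ` along which `P_n` converges at every point of the chamber
`{a < b < c < y}` simultaneously, to some function `G`. [folklore] -/
theorem exists_jointSubseqLimit (φ : ℕ → ℕ) (hφ : StrictMono φ) :
    ∃ ψ : ℕ → ℕ, StrictMono ψ ∧ ∃ G : ℝ → ℝ → ℝ → ℝ → ℝ, ∀ a b c y : ℝ, a < b → b < c → c < y →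
      Tendsto (fun n ↦ μ.real (openCrossing halfPlane (arcA a b (φ (ψ n)))
        (rowIcc ⌊c * (φ (ψ n) : ℕ)⌋ ⌊y * (φ (ψ n) : ℕ)⌋))) atTop (𝓝 (G a b c y)) := by
  obtain ⟨ψ, hψ, hrat⟩ := exists_subseq_tendsto_rat φ
  have hθ : StrictMono (φ ∘ ψ) := hφ.comp hψ
  have key : ∀ a b c y : ℝ, a < b → b < c → c < y → ∃ L : ℝ,
      Tendsto (fun n ↦ μ.real (openCrossing halfPlane (arcA a b (φ (ψ n)))
        (rowIcc ⌊c * (φ (ψ n) : ℕ)⌋ ⌊y * (φ (ψ n) : ℕ)⌋))) atTop (𝓝 L) :=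
    fun a b c y hab hbc hcy ↦ tendsto_real_of_tendsto_rat hθ hrat hab hbc hcy
  classical
  refine ⟨ψ, hψ, fun a b c y ↦ if h : a < b ∧ b < c ∧ c < y then (key a b c y h.1 h.2.1 h.2.2).choose
    else 0, fun a b c y hab hbc hcy ↦ ?_⟩
  simp only [dif_pos (And.intro hab (And.intro hbc hcy))]
  exact (key a b c y hab hbc hcy).choose_spec

/-! ## §6 Properties of every joint subsequential limit -/

section Limit

variable {θ : ℕ → ℕ} {G : ℝ → ℝ → ℝ → ℝ → ℝ}
  (hG : ∀ a b c y : ℝ, a < b → b < c → c < y →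
    Tendsto (fun n ↦ μ.real (openCrossing halfPlane (arcA a b (θ n))
      (rowIcc ⌊c * (θ n : ℕ)⌋ ⌊y * (θ n : ℕ)⌋))) atTop (𝓝 (G a b c y)))
include hG

/-- A joint subsequential limit takes values in `[0,1]`. [folklore] -/
theorem jointLimit_mem_Icc {a b c y : ℝ} (hab : a < b) (hbc : b < c) (hcy : c < y) :
    G a b c y ∈ Icc (0 : ℝ) 1 :=
  ⟨ge_of_tendsto' (hG a b c y hab hbc hcy) fun _ ↦ measureReal_nonneg,
    le_of_tendsto' (hG a b c y hab hbc hcy) fun _ ↦ measureReal_le_one⟩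

/-- **Monotonicity**: a joint subsequential limit is nondecreasing when both arcs grow. [folklore] -/
theorem jointLimit_mono {a a' b b' c c' y y' : ℝ} (ha : a' ≤ a) (hb : b ≤ b') (hc : c' ≤ c)
    (hy : y ≤ y') (hab : a < b) (hbc : b < c) (hcy : c < y) (hbc' : b' < c') :
    G a b c y ≤ G a' b' c' y' :=
  le_of_tendsto_of_tendsto' (hG a b c y hab hbc hcy)
    (hG a' b' c' y' (by linarith) hbc' (by linarith)) fun n ↦ P_mono ha hb hc hy (θ n)

/-- **The `δ`-move bound passes to the limit**: growing both arcs with every mark moving by `≤ δ`,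
`10δ ≤` the new gap, increases a joint subsequential limit by at most `4C(8δ/gap)^α` (for any
admissible escape constants `C, α`). [folklore] -/
theorem jointLimit_move_le (hθ : StrictMono θ) {C α : ℝ} (hC : 0 ≤ C) (hα : 0 < α)
    (hesc : ∀ p : unitInterval, (p : ℝ) ≤ 1 / 2 → ∀ r R : ℕ, 1 ≤ r → r ≤ R →
      (bondPercolation (zdGraph 2) p).real
        {ω | ∃ x ∈ box 2 r, ∃ y ∉ box 2 R, ω ∈ openConnIn Set.univ x y} ≤ C * ((r : ℝ) / R) ^ α)
    {a a' b b' c c' y y' δ : ℝ} (ha : a' ≤ a) (hb : b ≤ b') (hc : c' ≤ c) (hy : y ≤ y') (hab : a < b)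
    (hbc : b < c) (hcy : c < y) (hbc' : b' < c') (hδ : 0 < δ) (hda : a - a' ≤ δ) (hdb : b' - b ≤ δ)
    (hdc : c - c' ≤ δ) (hdy : y' - y ≤ δ) (hgap : 10 * δ ≤ c' - b') :
    G a' b' c' y' ≤ G a b c y + 4 * (C * (8 * δ / (c' - b')) ^ α) :=
  le_of_tendsto_of_tendsto (hG a' b' c' y' (by linarith) hbc' (by linarith))
    ((hG a b c y hab hbc hcy).add_const _)
    (hθ.tendsto_atTop.eventually
      (eventually_move_le hC hα hesc ha hb hc hy hab.le hcy.le hδ hda hdb hdc hdy hgap))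

/-- **Continuity**: a joint subsequential limit along a strictly increasing `θ` is continuous on the
chamber `{a < b < c < y}` (as a function on `ℝ × ℝ × ℝ × ℝ`). [folklore] -/
theorem continuousOn_of_jointLimit (hθ : StrictMono θ) :
    ContinuousOn (fun p : ℝ × ℝ × ℝ × ℝ ↦ G p.1 p.2.1 p.2.2.1 p.2.2.2)
      {p | p.1 < p.2.1 ∧ p.2.1 < p.2.2.1 ∧ p.2.2.1 < p.2.2.2} := by
  obtain ⟨C, α, hC0, hα, hesc⟩ := exists_real_boxToFar_le_rpow_of_le_half
  rw [Metric.continuousOn_iff]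
  rintro ⟨a, b, c, y⟩ ⟨hab, hbc, hcy⟩ ε hε
  simp only at hab hbc hcy
  have hg : 0 < c - b := by linarith
  obtain ⟨δ, hδ, hδ₀, herr⟩ := exists_small (C := C) hα (32 / (c - b)) (ε := ε)
    (δ₀ := min (min ((b - a) / 2) ((y - c) / 2)) ((c - b) / 22)) hε
    (lt_min (lt_min (by linarith) (by linarith)) (by linarith))
  have hδ1 : δ < (b - a) / 2 := lt_of_lt_of_le hδ₀ ((min_le_left _ _).trans (min_le_left _ _))
  have hδ2 : δ < (y - c) / 2 := lt_of_lt_of_le hδ₀ ((min_le_left _ _).trans (min_le_right _ _))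
  have hδ3 : δ < (c - b) / 22 := lt_of_lt_of_le hδ₀ (min_le_right _ _)
  refine ⟨δ, hδ, ?_⟩
  rintro ⟨a₁, b₁, c₁, y₁⟩ ⟨hab₁, hbc₁, hcy₁⟩ hdist
  simp only at hab₁ hbc₁ hcy₁ ⊢
  -- componentwise closeness from the sup metric
  have hd1 : dist a₁ a < δ := lt_of_le_of_lt (by rw [Prod.dist_eq]; exact le_max_left _ _) hdist
  have hd' : dist (b₁, c₁, y₁) (b, c, y) < δ :=
    lt_of_le_of_lt (by rw [Prod.dist_eq (x := (a₁, b₁, c₁, y₁))]; exact le_max_right _ _) hdist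
  have hd2 : dist b₁ b < δ := lt_of_le_of_lt (by rw [Prod.dist_eq]; exact le_max_left _ _) hd'
  have hd'' : dist (c₁, y₁) (c, y) < δ :=
    lt_of_le_of_lt (by rw [Prod.dist_eq (x := (b₁, c₁, y₁))]; exact le_max_right _ _) hd'
  have hd3 : dist c₁ c < δ := lt_of_le_of_lt (by rw [Prod.dist_eq]; exact le_max_left _ _) hd''
  have hd4 : dist y₁ y < δ :=
    lt_of_le_of_lt (by rw [Prod.dist_eq (x := (c₁, y₁))]; exact le_max_right _ _) hd''
  rw [Real.dist_eq, abs_lt] at hd1 hd2 hd3 hd4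
  -- corners z⁻ = (a+δ, b−δ, c+δ, y−δ) ≼ z, z₁ ≼ z⁺ = (a−δ, b+δ, c−δ, y+δ)
  have lo₀ := jointLimit_mono hG (a := a + δ) (a' := a) (b := b - δ) (b' := b) (c := c + δ) (c' := c)
    (y := y - δ) (y' := y) (by linarith) (by linarith) (by linarith) (by linarith) (by linarith)
    (by linarith) (by linarith) hbc
  have hi₀ := jointLimit_mono hG (a := a) (a' := a - δ) (b := b) (b' := b + δ) (c := c) (c' := c - δ)
    (y := y) (y' := y + δ) (by linarith) (by linarith) (by linarith) (by linarith) hab hbc hcy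
    (by linarith)
  have lo₁ := jointLimit_mono hG (a := a + δ) (a' := a₁) (b := b - δ) (b' := b₁) (c := c + δ)
    (c' := c₁) (y := y - δ) (y' := y₁) (by linarith) (by linarith) (by linarith) (by linarith)
    (by linarith) (by linarith) (by linarith) hbc₁
  have hi₁ := jointLimit_mono hG (a := a₁) (a' := a - δ) (b := b₁) (b' := b + δ) (c := c₁)
    (c' := c - δ) (y := y₁) (y' := y + δ) (by linarith) (by linarith) (by linarith) (by linarith)
    hab₁ hbc₁ hcy₁ (by linarith)
  have mv := jointLimit_move_le hG hθ hC0.le hα hesc (a := a + δ) (a' := a - δ) (b := b - δ)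
    (b' := b + δ) (c := c + δ) (c' := c - δ) (y := y - δ) (y' := y + δ) (δ := 2 * δ) (by linarith)
    (by linarith) (by linarith) (by linarith) (by linarith) (by linarith) (by linarith) (by linarith)
    (by linarith) (by linarith) (by linarith) (by linarith) (by linarith) (by linarith)
  have herr' : 4 * (C * (8 * (2 * δ) / (c - δ - (b + δ))) ^ α) < ε := by
    refine lt_of_le_of_lt ?_ herr
    have h1 : 8 * (2 * δ) / (c - δ - (b + δ)) ≤ 32 / (c - b) * δ := by
      rw [div_le_iff₀ (by linarith), div_mul_eq_mul_div, div_mul_eq_mul_div, le_div_iff₀ hg]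
      nlinarith
    have h2 : (8 * (2 * δ) / (c - δ - (b + δ))) ^ α ≤ (32 / (c - b) * δ) ^ α :=
      Real.rpow_le_rpow (div_nonneg (by positivity) (by linarith)) h1 hα.le
    nlinarith [mul_le_mul_of_nonneg_left h2 hC0.le]
  rw [Real.dist_eq, abs_lt]
  constructor <;> linarith

/-- **Translation invariance**: a joint subsequential limit is invariant under simultaneous
translation of the four marks (exact lattice translation + one-site moves cost `o(1)`). [folklore] -/
theorem translate_of_jointLimit (hθ : StrictMono θ) {a b c y : ℝ} (hab : a < b) (hbc : b < c)
    (hcy : c < y) (t : ℝ) :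
    G (a + t) (b + t) (c + t) (y + t) = G a b c y := by
  obtain ⟨C, α, -, hα, hesc⟩ := exists_real_boxToFar_le_rpow_of_le_half
  have h1 := hG (a + t) (b + t) (c + t) (y + t) (by linarith) (by linarith) (by linarith)
  have h2 := hG a b c y hab hbc hcy
  have h3 := hθ.tendsto_atTop
  have h4 := (tendsto_translate_sub hesc hα hab.le hbc hcy.le t).comp h3
  have h5 := h2.add h4
  simp only [add_zero] at h5
  refine tendsto_nhds_unique h1 (h5.congr fun n ↦ ?_)
  simp only [Function.comp_apply]
  ring

/-- **Boundary value at `η = 0`**: a joint subsequential limit is `≤ C((b−a)/(c−a))^α` for the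
tree's escape constants — it vanishes, uniformly, as the source arc shrinks. [folklore] -/
theorem jointLimit_le_small_source (hθ : StrictMono θ) {C α : ℝ} (hα : 0 < α)
    (hesc : ∀ p : unitInterval, (p : ℝ) ≤ 1 / 2 → ∀ r R : ℕ, 1 ≤ r → r ≤ R →
      (bondPercolation (zdGraph 2) p).real
        {ω | ∃ x ∈ box 2 r, ∃ y ∉ box 2 R, ω ∈ openConnIn Set.univ x y} ≤ C * ((r : ℝ) / R) ^ α)
    {a b c y : ℝ} (hab : a < b) (hbc : b < c) (hcy : c < y) :
    G a b c y ≤ C * ((b - a) / (c - a)) ^ α := by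
  refine le_of_tendsto_of_tendsto (hG a b c y hab hbc hcy)
    ((tendsto_small_source_bound (C := C) hα hab.le (hab.trans hbc)).comp hθ.tendsto_atTop) ?_
  have e5 : ∀ᶠ n : ℕ in atTop, 5 ≤ (c - b) * n :=
    (tendsto_natCast_atTop_atTop.const_mul_atTop (by linarith : 0 < c - b)).eventually_ge_atTop 5
  filter_upwards [hθ.tendsto_atTop.eventually e5] with n hn
  exact le_of_small_source hesc hab.le hn

/-- **Boundary value at `η = 0`, target side**: by the line's short-arc bound (`Converse.stub_shortArc`,
ConversePart1), a joint subsequential limit is `≤ (4(y−c)/(c−b))^α` once `y − c ≤ (c−b)/8` — it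
vanishes as the target arc shrinks. [folklore] -/
theorem jointLimit_le_small_target (hθ : StrictMono θ) {α : ℝ}
    (hshort : ∀ a b c x : ℝ, a < b → b < c → c < x → x - c ≤ (c - b) / 8 →
      ∀ᶠ n : ℕ in atTop, μ.real (openCrossing halfPlane (arcA a b n) (rowIcc ⌊c * n⌋ ⌊x * n⌋)) ≤
        (4 * (x - c) / (c - b)) ^ α)
    {a b c y : ℝ} (hab : a < b) (hbc : b < c) (hcy : c < y) (hsmall : y - c ≤ (c - b) / 8) :
    G a b c y ≤ (4 * (y - c) / (c - b)) ^ α :=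
  le_of_tendsto (hG a b c y hab hbc hcy) (hθ.tendsto_atTop.eventually (hshort a b c y hab hbc hcy hsmall))

end Limit

/-- **Uniform decay at `η = 0`, target side**, for all joint subsequential limits at once
(from `Converse.stub_shortArc`). [folklore] -/
theorem exists_jointLimit_target_decay :
    ∃ α : ℝ, 0 < α ∧ ∀ (θ : ℕ → ℕ), StrictMono θ → ∀ G : ℝ → ℝ → ℝ → ℝ → ℝ,
      (∀ a b c y : ℝ, a < b → b < c → c < y →
        Tendsto (fun n ↦ μ.real (openCrossing halfPlane (arcA a b (θ n))
          (rowIcc ⌊c * (θ n : ℕ)⌋ ⌊y * (θ n : ℕ)⌋))) atTop (𝓝 (G a b c y))) →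
      ∀ a b c y : ℝ, a < b → b < c → c < y → y - c ≤ (c - b) / 8 →
        G a b c y ≤ (4 * (y - c) / (c - b)) ^ α := by
  obtain ⟨α, hα, hshort⟩ := Converse.stub_shortArc
  exact ⟨α, hα, fun θ hθ G hG a b c y hab hbc hcy hsmall ↦
    jointLimit_le_small_target hG hθ hshort hab hbc hcy hsmall⟩

/-- **Uniform decay at `η = 0`** for all joint subsequential limits at once: there are universal
`C, α > 0` (the RSW one-arm constants of bond-`ℤ²`) with `G(a,b,c,y) ≤ C((b−a)/(c−a))^α` for every
joint subsequential limit `G` along every strictly increasing subsequence. [folklore] -/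
theorem exists_jointLimit_source_decay :
    ∃ C α : ℝ, 0 < C ∧ 0 < α ∧ ∀ (θ : ℕ → ℕ), StrictMono θ → ∀ G : ℝ → ℝ → ℝ → ℝ → ℝ,
      (∀ a b c y : ℝ, a < b → b < c → c < y →
        Tendsto (fun n ↦ μ.real (openCrossing halfPlane (arcA a b (θ n))
          (rowIcc ⌊c * (θ n : ℕ)⌋ ⌊y * (θ n : ℕ)⌋))) atTop (𝓝 (G a b c y))) →
      ∀ a b c y : ℝ, a < b → b < c → c < y → G a b c y ≤ C * ((b - a) / (c - a)) ^ α := by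
  obtain ⟨C, α, hC0, hα, hesc⟩ := exists_real_boxToFar_le_rpow_of_le_half
  exact ⟨C, α, hC0, hα, fun θ hθ G hG a b c y hab hbc hcy ↦
    jointLimit_le_small_source hG hθ hα hesc hab hbc hcy⟩

end Subseq

/-- **Registered extra stub of line `Sketch` (lead c2-0): PRECOMPACTNESS of the collinear half-plane
crossing function.**  Every strictly increasing `φ` has a further subsequence `φ ∘ ψ` along which
`P_n(a,b,c,y) = P_{1/2}[[⌊an⌋,⌊bn⌋]×{0} ↔ [⌊cn⌋,⌊yn⌋]×{0} in ℤ×ℕ]` converges at every point of the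
chamber `{a < b < c < y}` simultaneously. [folklore] -/
theorem stub_precompactness :
    ∀ φ : ℕ → ℕ, StrictMono φ → ∃ ψ : ℕ → ℕ, StrictMono ψ ∧ ∃ G : ℝ → ℝ → ℝ → ℝ → ℝ,
      ∀ a b c y : ℝ, a < b → b < c → c < y →
        Tendsto (fun n ↦ μ.real (openCrossing halfPlane (arcA a b (φ (ψ n)))
          (rowIcc ⌊c * (φ (ψ n) : ℕ)⌋ ⌊y * (φ (ψ n) : ℕ)⌋))) atTop (𝓝 (G a b c y)) :=
  Subseq.exists_jointSubseqLimit

end Summit.CriticalPhenomena.CardyFormulaZ2.Cruxes.HalfPlaneMarkDensityLaw.SketchLine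

end
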